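import Literature.NumberTheory.GaloisRepresentations.GaloisCohomologyUnitsLayerInflation
import Literature.NumberTheory.GaloisRepresentations.CyclicLayerCarry
import Literature.Algebra.Homology.UnramifiedClassModule
import HarnessLib

/-!
# The engine's Frobenius class `[c_σ · ϖ] ∈ H²(Gal(L/K), Lˣ)` inflates to the tree's cyclic class
# `κ_θ(ϖ) = [c_θ ⊗ ϖ] ∈ H²(K, K̄ˣ)` (Serre, *Local Fields* XIII §3 / XIV §1: the class of the cyclic
# algebra `(θ, ϖ)`; Neukirch, *Bonn Lectures* II §4 Def. (4.5))

Topic `NumberTheory/GaloisRepresentations`; namespace `Literature.NumberTheory.GaloisRepresentations`.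
Definitions with bodies and theorems; no named fact, no instance, no notation.  Sequel to
`GaloisCohomologyUnitsLayerInflation` (`unitsInfTwo : H²(Gal(L/K), Lˣ) ↪ H²(K, K̄ˣ)`).

For a field `K : Type` of characteristic `0`, a finite Galois `L ⊆ K̄` whose group is generated by `σ`,
and a `Gal(L/K)`-invariant `ϖ ∈ Lˣ`:
* §1 **`layerCyclicCharacter K L σ hσ : CyclicCharacter Γ_K |Gal(L/K)|`**, `γ ↦ ι(γ|_L)` where
  `σ^{ι(g)} = g` (the engine's `Unramified.exponent`) — continuous (it factors through the discrete
  quotient `Γ_K ⧸ Gal(K̄/L)`), onto, with `val_layerCyclicCharacter`, **`ker_layerCyclicCharacter :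
  ker θ = Gal(K̄/L)`** and `layerCyclicCharacter_eq_one_iff` (`θ γ = 1 ↔ γ|_L = σ` when `|Gal(L/K)| > 1`).
* §2 `baseUnitInvariant K L ϖ hϖ : (K̄ˣ)^{Γ_K}` (the invariant unit `ϖ` seen in `K̄`), and the comparison
  **`unitsInfTwo_H2π_frobeniusCocycle`**:
  `unitsInfTwo K L [c_σ · ϖ] = cyclicClass (layerCyclicCharacter K L σ hσ) (units K) ϖ` —
  the engine's Frobenius cocycle `(g, h) ↦ c_σ(g, h) · ϖ` (`Unramified.frobeniusCocycle`, carry of the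
  exponents) inflates ON THE NOSE to the tree's carry cocycle `(γ, γ') ↦ c_θ(γ, γ') · ϖ`
  (`carryCocycle`, `c_θ(γ, γ') = ⌊(θ̃ γ + θ̃ γ')/d⌋`).

Consequence for the bsd-schneider cell (crux `AnticycControlAdditiveK`, Route A): for a non-archimedean
local `K` and `L = K_m` the unramified level (door-c6 g9 `LocalUnramifiedLayerClassModule`: `(K_mˣ)` is an
unramified class module with fundamental class `[c_σ · π_K]`, `inv_σ = 1/m`), the image of the engine's
fundamental class in `Br(K) = H²(K, K̄ˣ)` IS the tree's unramified cyclic class `κ_θ(π_K)` of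
`LocalUnramifiedBrauer` / `LocalInvariantOfUnramifiedClass` (whose invariant the tree computes) — the local
normalisation agreement between the finite-group class-module engine and the tree's `invLevel`.

## References
* J.-P. Serre, *Local Fields*, GTM 67 (1979), Ch. XIII §3 (the unramified classes and `inv_K`), Ch. XIV §1
  Prop. 2 (`(χ, b) = b ∪ δχ`). [SerreLocalFields1979]
* J. Neukirch, *Class Field Theory — The Bonn Lectures* (2013), Part II §4 Def. (4.5). [Neukirch2013]
-/

noncomputable section

open CategoryTheory groupCohomology Field

namespace Literature.NumberTheory.GaloisRepresentations

open LocalWeilDatum DiscreteGaloisModule Literature.Algebra.Homology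

attribute [local instance] absoluteGaloisGroup_compactSpace

variable (K : Type) [Field K] [CharZero K]
variable (L : IntermediateField K (AlgebraicClosure K)) [FiniteDimensional K L] [IsGalois K L]
variable (σ : L ≃ₐ[K] L) (hσ : ∀ x, x ∈ Subgroup.zpowers σ)

/-! ## §1. The cyclic character `γ ↦ ι(γ|_L)` of the layer attached to the generator `σ` -/

omit [CharZero K] in
/-- **The cyclic character of the layer**: `θ_σ : Γ_K → ℤ/|Gal(L/K)|`, `γ ↦ ι(γ|_L) mod |Gal(L/K)|` where
`σ^{ι(g)} = g` — continuous (through the finite discrete quotient `Γ_K ⧸ Gal(K̄/L)`) and onto.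
[cite: SerreLocalFields1979, Ch. XIII §3][cite: Neukirch2013, Part II §4 (proof of (4.5))] -/
def layerCyclicCharacter : CyclicCharacter (absoluteGaloisGroup K) (Fintype.card (L ≃ₐ[K] L)) where
  toFun γ := (Unramified.exponent σ hσ (resGal L γ) : ZMod (Fintype.card (L ≃ₐ[K] L)))
  map_mul' γ γ' := by
    rw [map_mul, Unramified.exponent_mul, ZMod.natCast_mod, Nat.cast_add]
  continuous_toFun := by
    haveI := discreteTopology_quotient_absGaloisFixingSubgroup K L
    have h : (fun γ : absoluteGaloisGroup K =>
        (Unramified.exponent σ hσ (resGal L γ) : ZMod (Fintype.card (L ≃ₐ[K] L)))) =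
        (fun q : absoluteGaloisGroup K ⧸ absGaloisFixingSubgroup L =>
          (Unramified.exponent σ hσ (absGaloisQuotientEquiv K L q) : ZMod (Fintype.card (L ≃ₐ[K] L)))) ∘
        ((↑) : absoluteGaloisGroup K → absoluteGaloisGroup K ⧸ absGaloisFixingSubgroup L) := by
      funext γ
      rfl
    rw [h]
    exact (continuous_of_discreteTopology).comp QuotientGroup.continuous_mk
  surjective' k := by
    obtain ⟨γ, hγ⟩ := resGal_surjective L (σ ^ k.val)
    refine ⟨γ, ?_⟩
    change (Unramified.exponent σ hσ (resGal L γ) : ZMod _) = k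
    rw [hγ, Unramified.exponent_pow, ZMod.natCast_mod, ZMod.natCast_zmod_val]

omit [CharZero K] in
/-- Unfolding: `θ_σ γ = ι(γ|_L)`. [cite: Neukirch2013, Part II §4 (proof of (4.5))] -/
theorem layerCyclicCharacter_apply (γ : absoluteGaloisGroup K) :
    layerCyclicCharacter K L σ hσ γ =
      (Unramified.exponent σ hσ (resGal L γ) : ZMod (Fintype.card (L ≃ₐ[K] L))) := rfl

omit [CharZero K] in
/-- **`(θ_σ γ).val = ι(γ|_L)`** (the exponent is already reduced). [cite: Neukirch2013, Part II §4 (proof of (4.5))] -/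
theorem val_layerCyclicCharacter (γ : absoluteGaloisGroup K) :
    (layerCyclicCharacter K L σ hσ γ).val = Unramified.exponent σ hσ (resGal L γ) := by
  rw [layerCyclicCharacter_apply, ZMod.val_natCast,
    Nat.mod_eq_of_lt (Unramified.exponent_lt_card σ hσ _)]

omit [CharZero K] in
/-- **`ker θ_σ = Gal(K̄/L)`.** [cite: SerreLocalFields1979, Ch. XIII §3] -/
theorem ker_layerCyclicCharacter [NeZero (Fintype.card (L ≃ₐ[K] L))] :
    (layerCyclicCharacter K L σ hσ).ker = absGaloisFixingSubgroup L := by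
  ext γ
  rw [CyclicCharacter.mem_ker, absGaloisFixingSubgroup_eq_ker_resGal, MonoidHom.mem_ker,
    ← ZMod.val_eq_zero, val_layerCyclicCharacter]
  constructor
  · intro h
    rw [← Unramified.pow_exponent σ hσ (resGal L γ), h, pow_zero]
  · intro h
    rw [h, Unramified.exponent_one]

omit [CharZero K] in
/-- The carry of the character is the engine's carry of the restrictions:
`c_θ(γ, γ') = c_σ(γ|_L, γ'|_L)`. [cite: Neukirch2013, Part II §4 (proof of (4.5))][cite: SerreLocalFields1979, Ch. XIV §1] -/
theorem carryFun_layerCyclicCharacter (γ γ' : absoluteGaloisGroup K) :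
    (layerCyclicCharacter K L σ hσ).carryFun γ γ' =
      (Unramified.carry σ hσ (resGal L γ) (resGal L γ') : ℤ) := by
  rw [CyclicCharacter.carryFun, val_layerCyclicCharacter, val_layerCyclicCharacter, Unramified.carry]

/-! ## §2. The Frobenius class inflates to the cyclic class -/

variable (ϖ : (Rep.ofAlgebraAutOnUnits K L).V)
  (hϖ : ∀ g : L ≃ₐ[K] L, (Rep.ofAlgebraAutOnUnits K L).ρ g ϖ = ϖ)

omit [CharZero K] [FiniteDimensional K L] in
/-- An invariant unit `ϖ ∈ (Lˣ)^{Gal(L/K)}` seen in `K̄ˣ` is `Γ_K`-invariant.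
[cite: SerreLocalFields1979, Ch. XIII §3] -/
def baseUnitInvariant : (units K).toTopRep.ρ.invariants :=
  ⟨UnitsCarrier.ofUnits (Units.map (algebraMap L (AlgebraicClosure K) : L →* AlgebraicClosure K)
      (Additive.toMul ϖ)), fun γ => by
    change units K γ _ = _
    apply UnitsCarrier.toAdditive.injective
    rw [units_apply_apply]
    refine congrArg Additive.ofMul (Units.ext ?_)
    rw [Units.coe_smul]
    -- `γ • ϖ = (γ|_L) ϖ = ϖ`
    have h := hϖ (resGal L γ)
    have h' := congrArg (fun v : Additive (L : Type)ˣ =>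
      (((Additive.toMul v : (L : Type)ˣ) : L) : AlgebraicClosure K)) h
    change ((((Units.map ((resGal L γ : L ≃ₐ[K] L) : L →* L) (Additive.toMul ϖ)) : (L : Type)ˣ) : L) :
      AlgebraicClosure K) = _ at h'
    rw [Units.coe_map, MonoidHom.coe_coe, coe_resGal_apply] at h'
    exact h'⟩

omit [CharZero K] [FiniteDimensional K L] in
/-- Unfolding: the value of `baseUnitInvariant ϖ` in `K̄` is `ϖ`. [cite: SerreLocalFields1979, Ch. XIII §3] -/
@[simp] theorem coe_toMul_baseUnitInvariant :
    ((UnitsCarrier.toAdditive (baseUnitInvariant K L ϖ hϖ).1).toMul : AlgebraicClosure K) =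
      (((Additive.toMul ϖ : (L : Type)ˣ) : L) : AlgebraicClosure K) := rfl

omit [FiniteDimensional K L] [IsGalois K L] in
/-- Equivariance of the INVERSE identification `Additive Lˣ ≃ (K̄ˣ)^{Γ_L}` (from
`unitsLayerEquiv_equivariant`). [cite: SerreGaloisCohomology1997, I §2.6] -/
theorem unitsLayerEquiv_symm_equivariant [Normal K L]
    (g : absoluteGaloisGroup K ⧸ absGaloisFixingSubgroup L) :
    (unitsLayerEquiv K L).symm.toLinearMap ∘ₗ
        (Rep.ofAlgebraAutOnUnits K L).ρ (absGaloisQuotientEquiv K L g) =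
      (absGaloisLayerRep K L (units K)).ρ g ∘ₗ (unitsLayerEquiv K L).symm.toLinearMap := by
  apply LinearMap.ext
  intro x
  apply (unitsLayerEquiv K L).injective
  change unitsLayerEquiv K L ((unitsLayerEquiv K L).symm
      ((Rep.ofAlgebraAutOnUnits K L).ρ (absGaloisQuotientEquiv K L g) x)) =
    unitsLayerEquiv K L ((absGaloisLayerRep K L (units K)).ρ g ((unitsLayerEquiv K L).symm x))
  rw [LinearEquiv.apply_symm_apply]
  have h := LinearMap.congr_fun (unitsLayerEquiv_equivariant K L g) ((unitsLayerEquiv K L).symm x)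
  change unitsLayerEquiv K L ((absGaloisLayerRep K L (units K)).ρ g ((unitsLayerEquiv K L).symm x)) =
    (Rep.ofAlgebraAutOnUnits K L).ρ (absGaloisQuotientEquiv K L g)
      (unitsLayerEquiv K L ((unitsLayerEquiv K L).symm x)) at h
  rw [LinearEquiv.apply_symm_apply] at h
  exact h.symm

/-- The morphism `Res_e (Lˣ) ⟶ (K̄ˣ)^{Γ_L}` of representations underlying the inverse of
`unitsLayerH2Iso` (Mathlib `groupCohomology.mapIso_inv`). [cite: SerreGaloisCohomology1997, I §2.6] -/
def unitsLayerInvHom :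
    Rep.res (absGaloisQuotientEquiv K L : _ →* _) (Rep.ofAlgebraAutOnUnits K L) ⟶
      absGaloisLayerRep K L (units K) :=
  Rep.ofHom ⟨(unitsLayerEquiv K L).symm.toLinearMap, unitsLayerEquiv_symm_equivariant K L⟩

omit [FiniteDimensional K L] in
/-- The inverse of `unitsLayerH2Iso` on the class of a cocycle `f`: the class of the transported
cocycle `(q, q') ↦ unitsLayerEquiv⁻¹ (f (e q, e q'))`. [cite: SerreGaloisCohomology1997, I §2.6] -/
theorem unitsLayerH2Iso_inv_H2π (f : cocycles₂ (Rep.ofAlgebraAutOnUnits K L)) :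
    (unitsLayerH2Iso K L).inv (H2π _ f) =
      H2π (absGaloisLayerRep K L (units K))
        (mapCocycles₂ _ (unitsLayerInvHom K L) f) := by
  have h1 : (unitsLayerH2Iso K L).inv = groupCohomology.map _ (unitsLayerInvHom K L) 2 := by
    rw [unitsLayerH2Iso, groupCohomology.mapIso_inv]
    rfl
  rw [h1]
  exact groupCohomology.H2π_comp_map_apply _ _ f

/-- **The engine's Frobenius class inflates to the tree's cyclic class:
`unitsInfTwo [c_σ · ϖ] = κ_{θ_σ}(ϖ) = [c_{θ_σ} ⊗ ϖ]`** in `H²(K, K̄ˣ)` — the inflated cocycle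
`(γ, γ') ↦ c_σ(γ|_L, γ'|_L) · ϖ` is the carry cocycle of `θ_σ` with value `ϖ` on the nose.
[cite: SerreLocalFields1979, Ch. XIV §1 Prop. 2][cite: Neukirch2013, Part II §4 Def. (4.5)] -/
theorem unitsInfTwo_H2π_frobeniusCocycle :
    unitsInfTwo K L (H2π _ (Unramified.frobeniusCocycle σ hσ (Rep.ofAlgebraAutOnUnits K L) ϖ hϖ)) =
      cyclicClass (layerCyclicCharacter K L σ hσ) (units K) (baseUnitInvariant K L ϖ hϖ) := by
  rw [← Iso.inv_hom_id_apply (unitsLayerH2Iso K L) (H2π _ _), unitsInfTwo_apply_hom,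
    unitsLayerH2Iso_inv_H2π, infTwo_H2π, cyclicClass_apply]
  refine congrArg _ (Subtype.ext (ContinuousMap.ext fun q => ?_))
  obtain ⟨γ, γ'⟩ := q
  rw [inflateTwoCocycle_apply, carryCocycle_apply, carryFun_layerCyclicCharacter]
  -- unfold the transported cocycle at `(γ̄, γ̄')`
  change Subtype.val ((unitsLayerEquiv K L).symm
      ((Unramified.frobeniusCocycle σ hσ (Rep.ofAlgebraAutOnUnits K L) ϖ hϖ : _ → _)
        (absGaloisQuotientEquiv K L γ, absGaloisQuotientEquiv K L γ'))) = _
  rw [Unramified.frobeniusCocycle_apply, absGaloisQuotientEquiv_mk, absGaloisQuotientEquiv_mk]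
  -- `e'⁻¹` is `ℤ`-linear and `↑(e'⁻¹ ϖ) = ϖ ∈ K̄ˣ` definitionally
  exact congrArg Subtype.val ((unitsLayerEquiv K L).symm.map_smul
    ((Unramified.carry σ hσ (resGal L γ) (resGal L γ') : ℤ)) ϖ)

end Literature.NumberTheory.GaloisRepresentations

end
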